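import Summits.QuantumFields.YangMills.Theorems.BalabanUVNodesSpineReadingOfRecord13CoPHKComponentSizeBlocks
import Summits.QuantumFields.YangMills.Theorems.BalabanUVNodesN20FinalLevelRatioDomination

/-!
# THE COMPONENT-SIZE FACE FED BY PER-HISTORY FIBREWISE LETTERS: the block energy letters hE of `…CoPHKComponentSizeBlocks` — «the coarse classes whose level-`j` large-field region
# covers the block animal `A` weigh at most `δ^n` of the total» — follow, per `(K, t, j, A)` and per run, from ONE per-history FIBREWISE letter at the FINAL level on the histories of
# that event together with a removal map whose fibres count to `≤ δ^n`; hence the lineage's `RelWeightBound` face at the block-grain cardinality dial from such letters BY NAME —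
# no tower, no telescoping (T), no pin

Cell `pub-ymgap`, YM-PLAN Track A (HUMAN RULING D-0062); seat `pub-ymgap-dag-n20-d` (R134 (a) N20 NE7b s3), gen 39; companion of `…N20FinalLevelRatioDomination` (gen 39, p768103: §4
`sum_classWeightOfDatum₉_le_mul_sum_of_fibreDom`), of `…CoPHKComponentSizeBlocks` (gen 33: `relWeightBound_card_of_blockEnergyLetters(_geometric)`, hypotheses hEA ∕ hEB) and of
`…SpineReadingOfRecord13CoPH(K)` (keys `keyA₁₃ ∕ keyB₁₃`, `classSet₁₃`, `weightA₁₃ ∕ weightB₁₃`, coarse `classSetK₁₃ ∕ weightAK₁₃ ∕ weightBK₁₃ ∕ badClassK₁₃`, `sum_bad_weightAK₁₃_eq`).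
`--kind proof --supports stmt-QuantumFields-27366 --as helper` (K3⁸); COUNT-NEUTRAL; THEOREMS ONLY (0 `def`).  [IV] = [Balaban1989LargeFieldI]; [LF-II] = [Balaban1989LargeFieldII].

WHY.  LOCATED-5 (K3⁸ evidence #58): at a history-rewriting pin a successive-conditioning tower is not print's currency, but a sup bound on [IV] (0.3)'s fibre ratio between a history and the
history with components declared small INTEGRATES, so a bad class of FINAL-level histories is dominated by ONE per-history letter plus fibre counting (p768103).  The lineage's
component-size face consumes exactly such class inequalities, keyed: hEA ∕ hEB are stated on the COARSE KEYED weights `weightAK₁₃ ∕ weightBK₁₃`, which are fibre sums of the dressed class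
weights `classWeightOfDatum₉` over the histories of each run reading to a key (§1 makes this a sum over HISTORIES: `Σ_{u bad} weightAK u = Σ_{s : kr (keyA s) bad} cw_A(s)`,
`Σ_{u} weightAK u = Σ_s cw_A(s)`).  So hEA(K, t, j, A) ⇐ [a removal map `rm` on run A's level-`K₀+K` histories, fibre sets, factors, with the fibrewise letter on the event's
histories and `Σ_{event, rm s = σ} z ≤ δ K j ^ n K j`] (§2), and the face follows (§3).  In print the factor is [LF-II] (1.79) «for all large field regions» with the improved (1.89)
(p. 387 ll. 25–29: `−κ₁d_k(X)` — the SIZE budget, which is what prices «`n` blocks all large-field»); no banking of renewals is needed for this reading.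

WHAT IS PROVED (kernel; finite-sum bookkeeping over the companions).  §1 `sum_filter_weightA₁₃_eq_sum_hist` ∕ `…B…` (a filtered sum of fine keyed weights = the sum of `cw` over the
histories whose key passes the filter), `sum_classSet_weightA₁₃_eq_sum_hist` ∕ `…B…` (totals), ★ `sum_badK_weightAK₁₃_eq_sum_hist` ∕ `…BK…` (the coarse bad mass = the `cw`-mass of the
histories whose coarse key is bad), ★ `sum_classSetK_weightAK₁₃_eq_sum_hist` ∕ `…BK…`.  §2 ★★ `badMassA_le_of_fibreDom` ∕ `badMassB_le_of_fibreDom` (ANY bad-key reading `bd`: per-history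
fibrewise letter on the histories reading into the coarse bad class + fibre count `≤ W` + displayed measurability ∕ integrability of the pieces ⇒ `Σ_{bad} weightAK ≤ W·Σ weightAK`;
non-negativity of the pieces BY NAME from `Provisos₁₃CoPH` via `wOfRecord₉_nonneg_of_provisos₁₃CoPH` + n19's `dressedSlotsOfDatum₉_nonneg`).  §3 ★★★
`relWeightBound_card_of_fibreDomLetters_geometric`: the face `relWeightBound_card_of_blockEnergyLetters_geometric` with hEA ∕ hEB DISCHARGED from per-`(K, t, j, A)` removal data carrying
the fibrewise letters and the counts `≤ δ K j ^ n K j` (existentially displayed), the schedule numerics unchanged ⇒ `RelWeightBound 1 (classSetK₁₃ …) (weightAK₁₃ …) (weightBK₁₃ …)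
(badClassK₁₃ … bigComponent …) (K ↦ δ₀·2^{−(K+1)})`.

HONEST FRAMING.  [bookkeeping].  The per-history letters are HYPOTHESES ([LF-II] (1.79)∕(1.89)⁺'s KIND on [IV] (0.3)'s fibre ratio — an ESTIMATE; junction NC-NE7b-α UNRULED); the removal
maps with their fibre counts are DATA (a DEFINER object on def-T's index: [IV] p. 177, def-R `PpSelOfRecord` docstring); measurability ∕ integrability of the dressed pieces at the record are
displayed provisos (K0c shapes); the schedule numerics are the face's own.  Whether the component-SIZE bad class serves U5 is the planners' reading (gen 33–34), not decided here.  NO weight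
is bounded, NO estimate proved; nothing of Bałaban's asserted; NE7 ∕ NE7b ∕ NE7c NOT PRINTED for `d = 4` ∕ NOT proved; no `Provisos₁₃CoPH` inhabitant claimed (K0⁷ OPEN); K3⁸ untouched; N20 NOT
discharged; counts UNMOVED (typed 28∕28 · discharged 8∕27); one finite four-torus programme at fixed `ε` — NOT ℝ⁴, NOT OS, NOT a mass gap, NOT the Clay problem.  No `def`, no `instance`,
no `notation`, no `sorry`; no decl below carries a cite tag.
-/

noncomputable section

open MeasureTheory
open scoped BigOperators
open Finset

namespace YMDAG.UVSplit

open Literature.MathematicalPhysics.QuantumFieldTheory.Balaban1983to89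
open Literature.MathematicalPhysics.QuantumFieldTheory.Balaban1983to89.T4Continuum
open Literature.MathematicalPhysics.QuantumFieldTheory.Balaban1983to89.Node00
open Literature.MathematicalPhysics.QuantumFieldTheory.Balaban1983to89.B5Eq118OneStroke (iterBlockOf iterBlock)
open Literature.MathematicalPhysics.QuantumFieldTheory.Balaban1983to89.B15.BasicStep (fibreIntegral)
open T4WeightBudget (RelWeightBound)
open Summit.QuantumFields.YangMills.BalabanUVNodes.N19MGFRoadLiveSelectorTower (dressedSlotsOfDatum₉_nonneg)
open Summit.QuantumFields.YangMills.BalabanUVNodes.N21KeyedShellWeightShellZero (wOfRecord₉_nonneg_of_provisos₁₃CoPH)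

variable {F : T4Family} {N : ℕ} [NeZero N]

/-! ## §1 Keyed sums are sums over histories -/

section Keys

variable (θ : Stage13HParams F N) (hP : θ.Provisos₁₃CoPH F N) (K₀ : ℕ) (g₀ : ℕ → ℝ) (os : List (ULoop F))

/-- **A FILTERED SUM OF RUN A's FINE KEYED WEIGHTS IS A SUM OVER HISTORIES**: `Σ_{x ∈ classSet₁₃ : P x} weightA₁₃ x = Σ_{s : P (keyA s)} cw_A(s)` (every history's key is a class;
fibrewise regrouping). [bookkeeping] -/
theorem sum_filter_weightA₁₃_eq_sum_hist (K : ℕ) (t : ℝ) (Pk : (Σ K, SiteSeqKey F (K₀ + K)) → Prop) [DecidablePred Pk] :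
    (letI : ∀ Kc, DecidableEq (SiteSeqKey F Kc) := fun _ => Classical.decEq _
      ∑ x ∈ (classSet₁₃ θ K₀ g₀ K).filter Pk, weightA₁₃ θ hP K₀ g₀ os K t x) =
      ∑ s ∈ Finset.univ.filter (fun s => Pk (keyA₁₃ θ K₀ g₀ K s)),
        classWeightOfDatum₉ F N θ.toStage9Params (datumOfRecord₁₃CoPH F N θ hP) g₀ os (runA₁₃ F K₀ g₀ K) (histA₁₃ θ K₀ g₀ K) (K₀ + K) t s := by
  letI : ∀ Kc, DecidableEq (SiteSeqKey F Kc) := fun _ => Classical.decEq _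
  unfold weightA₁₃
  have hmaps : ∀ s ∈ Finset.univ.filter (fun s => Pk (keyA₁₃ θ K₀ g₀ K s)), keyA₁₃ θ K₀ g₀ K s ∈ (classSet₁₃ θ K₀ g₀ K).filter Pk := by
    intro s hs
    refine Finset.mem_filter.2 ⟨?_, (Finset.mem_filter.1 hs).2⟩
    unfold classSet₁₃
    exact Finset.mem_union_left _ (Finset.mem_image_of_mem _ (Finset.mem_univ s))
  rw [← Finset.sum_fiberwise_of_maps_to hmaps]
  refine Finset.sum_congr rfl fun x hx => Finset.sum_congr ?_ fun _ _ => rfl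
  ext s
  simp only [Finset.mem_filter, Finset.mem_univ, true_and]
  constructor
  · intro h
    exact ⟨by rw [h]; exact (Finset.mem_filter.1 hx).2, h⟩
  · intro h
    exact h.2

/-- The same for run B (block-down keys of the level-`K₀+K+1` histories). [bookkeeping] -/
theorem sum_filter_weightB₁₃_eq_sum_hist (K : ℕ) (t : ℝ) (Pk : (Σ K, SiteSeqKey F (K₀ + K)) → Prop) [DecidablePred Pk] :
    (letI : ∀ Kc, DecidableEq (SiteSeqKey F Kc) := fun _ => Classical.decEq _
      ∑ x ∈ (classSet₁₃ θ K₀ g₀ K).filter Pk, weightB₁₃ θ hP K₀ g₀ os K t x) =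
      ∑ s' ∈ Finset.univ.filter (fun s' => Pk (keyB₁₃ θ K₀ g₀ K s')),
        classWeightOfDatum₉ F N θ.toStage9Params (datumOfRecord₁₃CoPH F N θ hP) g₀ os (runB₁₃ F K₀ g₀ K) (histB₁₃ θ K₀ g₀ K) (K₀ + K + 1) t s' := by
  letI : ∀ Kc, DecidableEq (SiteSeqKey F Kc) := fun _ => Classical.decEq _
  unfold weightB₁₃
  have hmaps : ∀ s' ∈ Finset.univ.filter (fun s' => Pk (keyB₁₃ θ K₀ g₀ K s')), keyB₁₃ θ K₀ g₀ K s' ∈ (classSet₁₃ θ K₀ g₀ K).filter Pk := by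
    intro s' hs'
    refine Finset.mem_filter.2 ⟨?_, (Finset.mem_filter.1 hs').2⟩
    unfold classSet₁₃
    exact Finset.mem_union_right _ (Finset.mem_image_of_mem _ (Finset.mem_univ s'))
  rw [← Finset.sum_fiberwise_of_maps_to hmaps]
  refine Finset.sum_congr rfl fun x hx => Finset.sum_congr ?_ fun _ _ => rfl
  ext s'
  simp only [Finset.mem_filter, Finset.mem_univ, true_and]
  constructor
  · intro h
    exact ⟨by rw [h]; exact (Finset.mem_filter.1 hx).2, h⟩
  · intro h
    exact h.2

/-- Run A's TOTAL over the class set of record is the sum of `cw_A` over ALL level-`K₀+K` histories. [bookkeeping] -/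
theorem sum_classSet_weightA₁₃_eq_sum_hist (K : ℕ) (t : ℝ) :
    ∑ x ∈ classSet₁₃ θ K₀ g₀ K, weightA₁₃ θ hP K₀ g₀ os K t x =
      ∑ s, classWeightOfDatum₉ F N θ.toStage9Params (datumOfRecord₁₃CoPH F N θ hP) g₀ os (runA₁₃ F K₀ g₀ K) (histA₁₃ θ K₀ g₀ K) (K₀ + K) t s := by
  have h := sum_filter_weightA₁₃_eq_sum_hist θ hP K₀ g₀ os K t (fun _ => True)
  rw [Finset.filter_true_of_mem (fun _ _ => trivial), Finset.filter_true_of_mem (fun _ _ => trivial)] at h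
  exact h

/-- Run B's TOTAL over the class set of record is the sum of `cw_B` over ALL level-`K₀+K+1` histories. [bookkeeping] -/
theorem sum_classSet_weightB₁₃_eq_sum_hist (K : ℕ) (t : ℝ) :
    ∑ x ∈ classSet₁₃ θ K₀ g₀ K, weightB₁₃ θ hP K₀ g₀ os K t x =
      ∑ s', classWeightOfDatum₉ F N θ.toStage9Params (datumOfRecord₁₃CoPH F N θ hP) g₀ os (runB₁₃ F K₀ g₀ K) (histB₁₃ θ K₀ g₀ K) (K₀ + K + 1) t s' := by
  have h := sum_filter_weightB₁₃_eq_sum_hist θ hP K₀ g₀ os K t (fun _ => True)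
  rw [Finset.filter_true_of_mem (fun _ _ => trivial), Finset.filter_true_of_mem (fun _ _ => trivial)] at h
  exact h

variable (kr : ℕ → (Σ K, SiteSeqKey F (K₀ + K)) → (Σ K, SiteSeqKey F (K₀ + K))) (bd : ℕ → (Σ K, SiteSeqKey F (K₀ + K)) → Prop)

open scoped Classical in
/-- ★ **THE COARSE BAD MASS OF RUN A IS THE `cw`-MASS OF THE HISTORIES WHOSE COARSE KEY IS BAD**: `Σ_{u ∈ badClassK} weightAK u = Σ_{s : kr (keyA s) ∈ badClassK} cw_A(s)`
(`sum_bad_weightAK₁₃_eq` + §1). [bookkeeping] -/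
theorem sum_badK_weightAK₁₃_eq_sum_hist (K : ℕ) (t : ℝ) :
    ∑ u ∈ badClassK₁₃ θ K₀ g₀ kr bd K t, weightAK₁₃ θ hP K₀ g₀ os kr K t u =
      ∑ s ∈ Finset.univ.filter (fun s => kr K (keyA₁₃ θ K₀ g₀ K s) ∈ badClassK₁₃ θ K₀ g₀ kr bd K t),
        classWeightOfDatum₉ F N θ.toStage9Params (datumOfRecord₁₃CoPH F N θ hP) g₀ os (runA₁₃ F K₀ g₀ K) (histA₁₃ θ K₀ g₀ K) (K₀ + K) t s := by
  rw [sum_bad_weightAK₁₃_eq]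
  convert sum_filter_weightA₁₃_eq_sum_hist θ hP K₀ g₀ os K t (fun x => kr K x ∈ badClassK₁₃ θ K₀ g₀ kr bd K t) using 3

open scoped Classical in
/-- ★ The same for run B. [bookkeeping] -/
theorem sum_badK_weightBK₁₃_eq_sum_hist (K : ℕ) (t : ℝ) :
    ∑ u ∈ badClassK₁₃ θ K₀ g₀ kr bd K t, weightBK₁₃ θ hP K₀ g₀ os kr K t u =
      ∑ s' ∈ Finset.univ.filter (fun s' => kr K (keyB₁₃ θ K₀ g₀ K s') ∈ badClassK₁₃ θ K₀ g₀ kr bd K t),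
        classWeightOfDatum₉ F N θ.toStage9Params (datumOfRecord₁₃CoPH F N θ hP) g₀ os (runB₁₃ F K₀ g₀ K) (histB₁₃ θ K₀ g₀ K) (K₀ + K + 1) t s' := by
  rw [sum_bad_weightBK₁₃_eq]
  convert sum_filter_weightB₁₃_eq_sum_hist θ hP K₀ g₀ os K t (fun x => kr K x ∈ badClassK₁₃ θ K₀ g₀ kr bd K t) using 3

/-- ★ **RUN A's COARSE TOTAL IS THE `cw`-MASS OF ALL ITS HISTORIES** (`sum_weightAK₁₃_eq` + §1). [bookkeeping] -/
theorem sum_classSetK_weightAK₁₃_eq_sum_hist (K : ℕ) (t : ℝ) :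
    ∑ u ∈ classSetK₁₃ θ K₀ g₀ kr K, weightAK₁₃ θ hP K₀ g₀ os kr K t u =
      ∑ s, classWeightOfDatum₉ F N θ.toStage9Params (datumOfRecord₁₃CoPH F N θ hP) g₀ os (runA₁₃ F K₀ g₀ K) (histA₁₃ θ K₀ g₀ K) (K₀ + K) t s := by
  rw [sum_weightAK₁₃_eq, sum_classSet_weightA₁₃_eq_sum_hist]

/-- ★ The same for run B. [bookkeeping] -/
theorem sum_classSetK_weightBK₁₃_eq_sum_hist (K : ℕ) (t : ℝ) :
    ∑ u ∈ classSetK₁₃ θ K₀ g₀ kr K, weightBK₁₃ θ hP K₀ g₀ os kr K t u =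
      ∑ s', classWeightOfDatum₉ F N θ.toStage9Params (datumOfRecord₁₃CoPH F N θ hP) g₀ os (runB₁₃ F K₀ g₀ K) (histB₁₃ θ K₀ g₀ K) (K₀ + K + 1) t s' := by
  rw [sum_weightBK₁₃_eq, sum_classSet_weightB₁₃_eq_sum_hist]

end Keys

/-! ## §2 A coarse bad class, any reading, weighs ≤ W of the run's total from ONE per-history fibrewise letter + a fibre count -/

section Letters

variable (θ : Stage13HParams F N) (hP : θ.Provisos₁₃CoPH F N) (K₀ : ℕ) (g₀ : ℕ → ℝ) (os : List (ULoop F))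
  (kr : ℕ → (Σ K, SiteSeqKey F (K₀ + K)) → (Σ K, SiteSeqKey F (K₀ + K))) (bd : ℕ → (Σ K, SiteSeqKey F (K₀ + K)) → Prop)

open scoped Classical in
/-- ★★ **RUN A's COARSE BAD MASS FROM ONE PER-HISTORY FIBREWISE LETTER.**  At `(K, t)`, for ANY bad-key reading `bd`: let `B` be the level-`K₀+K` histories of run A whose coarse key is bad;
given a removal map `rm`, fibre sets `fib`, factors `z` with the letter hDom «`∫⌈_{fib s}(χ·slot)(s) ≤ z s · ∫⌈_{fib s}(χ·slot)(rm s)` at every `V`, `s ∈ B`» and the fibre count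
«`Σ_{s ∈ B : rm s = σ} z s ≤ W`» (`0 ≤ W`), and the displayed measurability ∕ integrability of the dressed pieces (non-negativity BY NAME from `hP`):
`Σ_{u ∈ badClassK} weightAK u ≤ W · Σ_{u ∈ classSetK} weightAK u`. [bookkeeping] -/
theorem badMassA_le_of_fibreDom (K : ℕ) (t : ℝ)
    (rm : SeqOfRecord F θ.ν θ.τ9.M (histA₁₃ θ K₀ g₀ K) (K₀ + K) (K₀ + K) → SeqOfRecord F θ.ν θ.τ9.M (histA₁₃ θ K₀ g₀ K) (K₀ + K) (K₀ + K))
    (fib : SeqOfRecord F θ.ν θ.τ9.M (histA₁₃ θ K₀ g₀ K) (K₀ + K) (K₀ + K) → Finset (PBond (F.P (K₀ + K)) (K₀ + K)))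
    (z : SeqOfRecord F θ.ν θ.τ9.M (histA₁₃ θ K₀ g₀ K) (K₀ + K) (K₀ + K) → ℝ) {W : ℝ} (hW0 : 0 ≤ W)
    (hm : ∀ s, Measurable fun V => chiSeqOfRecord F N θ.ν θ.τ9.M (histA₁₃ θ K₀ g₀ K) (K₀ + K) (K₀ + K) s V *
      dressedSlotsOfDatum₉ F N θ.toStage9Params (datumOfRecord₁₃CoPH F N θ hP) g₀ os t (runA₁₃ F K₀ g₀ K) (histA₁₃ θ K₀ g₀ K) (K₀ + K) s V)
    (hint : ∀ s, Integrable (fun V => chiSeqOfRecord F N θ.ν θ.τ9.M (histA₁₃ θ K₀ g₀ K) (K₀ + K) (K₀ + K) s V *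
      dressedSlotsOfDatum₉ F N θ.toStage9Params (datumOfRecord₁₃CoPH F N θ hP) g₀ os t (runA₁₃ F K₀ g₀ K) (histA₁₃ θ K₀ g₀ K) (K₀ + K) s V)
      (fieldMeasure (F.P (K₀ + K)) (K₀ + K) (SU N)))
    (hDom : ∀ s, kr K (keyA₁₃ θ K₀ g₀ K s) ∈ badClassK₁₃ θ K₀ g₀ kr bd K t → ∀ V,
      fibreIntegral (fib s) (fun V => chiSeqOfRecord F N θ.ν θ.τ9.M (histA₁₃ θ K₀ g₀ K) (K₀ + K) (K₀ + K) s V *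
          dressedSlotsOfDatum₉ F N θ.toStage9Params (datumOfRecord₁₃CoPH F N θ hP) g₀ os t (runA₁₃ F K₀ g₀ K) (histA₁₃ θ K₀ g₀ K) (K₀ + K) s V) V ≤
        z s * fibreIntegral (fib s) (fun V => chiSeqOfRecord F N θ.ν θ.τ9.M (histA₁₃ θ K₀ g₀ K) (K₀ + K) (K₀ + K) (rm s) V *
          dressedSlotsOfDatum₉ F N θ.toStage9Params (datumOfRecord₁₃CoPH F N θ hP) g₀ os t (runA₁₃ F K₀ g₀ K) (histA₁₃ θ K₀ g₀ K) (K₀ + K) (rm s) V) V)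
    (hW : ∀ σ, ∑ s ∈ (Finset.univ.filter fun s => kr K (keyA₁₃ θ K₀ g₀ K s) ∈ badClassK₁₃ θ K₀ g₀ kr bd K t).filter (fun s => rm s = σ), z s ≤ W) :
    ∑ u ∈ badClassK₁₃ θ K₀ g₀ kr bd K t, weightAK₁₃ θ hP K₀ g₀ os kr K t u ≤ W * ∑ u ∈ classSetK₁₃ θ K₀ g₀ kr K, weightAK₁₃ θ hP K₀ g₀ os kr K t u := by
  rw [sum_badK_weightAK₁₃_eq_sum_hist, sum_classSetK_weightAK₁₃_eq_sum_hist]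
  have h0 : ∀ s V, 0 ≤ chiSeqOfRecord F N θ.ν θ.τ9.M (histA₁₃ θ K₀ g₀ K) (K₀ + K) (K₀ + K) s V *
      dressedSlotsOfDatum₉ F N θ.toStage9Params (datumOfRecord₁₃CoPH F N θ hP) g₀ os t (runA₁₃ F K₀ g₀ K) (histA₁₃ θ K₀ g₀ K) (K₀ + K) s V :=
    fun s V => mul_nonneg (chiSeqOfRecord_nonneg F N θ.ν θ.τ9.M _ _ _ s V)
      (dressedSlotsOfDatum₉_nonneg F N θ.toStage9Params (datumOfRecord₁₃CoPH F N θ hP) g₀ os (runA₁₃ F K₀ g₀ K) (histA₁₃ θ K₀ g₀ K)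
        (wOfRecord₉_nonneg_of_provisos₁₃CoPH F θ hP (runA₁₃ F K₀ g₀ K) (histA₁₃ θ K₀ g₀ K)) t (K₀ + K) s V)
  exact sum_classWeightOfDatum₉_le_mul_sum_of_fibreDom θ.toStage9Params (datumOfRecord₁₃CoPH F N θ hP) g₀ os (runA₁₃ F K₀ g₀ K) (histA₁₃ θ K₀ g₀ K)
    (K₀ + K) t _ rm fib z hW0 hm h0 hint (fun s hs => hDom s (Finset.mem_filter.1 hs).2) (fun σ _ => hW σ)

open scoped Classical in
/-- ★★ **RUN B's COARSE BAD MASS FROM ONE PER-HISTORY FIBREWISE LETTER**, likewise on the level-`K₀+K+1` histories of run B. [bookkeeping] -/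
theorem badMassB_le_of_fibreDom (K : ℕ) (t : ℝ)
    (rm : SeqOfRecord F θ.ν θ.τ9.M (histB₁₃ θ K₀ g₀ K) (K₀ + K + 1) (K₀ + K + 1) → SeqOfRecord F θ.ν θ.τ9.M (histB₁₃ θ K₀ g₀ K) (K₀ + K + 1) (K₀ + K + 1))
    (fib : SeqOfRecord F θ.ν θ.τ9.M (histB₁₃ θ K₀ g₀ K) (K₀ + K + 1) (K₀ + K + 1) → Finset (PBond (F.P (K₀ + K + 1)) (K₀ + K + 1)))
    (z : SeqOfRecord F θ.ν θ.τ9.M (histB₁₃ θ K₀ g₀ K) (K₀ + K + 1) (K₀ + K + 1) → ℝ) {W : ℝ} (hW0 : 0 ≤ W)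
    (hm : ∀ s', Measurable fun V => chiSeqOfRecord F N θ.ν θ.τ9.M (histB₁₃ θ K₀ g₀ K) (K₀ + K + 1) (K₀ + K + 1) s' V *
      dressedSlotsOfDatum₉ F N θ.toStage9Params (datumOfRecord₁₃CoPH F N θ hP) g₀ os t (runB₁₃ F K₀ g₀ K) (histB₁₃ θ K₀ g₀ K) (K₀ + K + 1) s' V)
    (hint : ∀ s', Integrable (fun V => chiSeqOfRecord F N θ.ν θ.τ9.M (histB₁₃ θ K₀ g₀ K) (K₀ + K + 1) (K₀ + K + 1) s' V *
      dressedSlotsOfDatum₉ F N θ.toStage9Params (datumOfRecord₁₃CoPH F N θ hP) g₀ os t (runB₁₃ F K₀ g₀ K) (histB₁₃ θ K₀ g₀ K) (K₀ + K + 1) s' V)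
      (fieldMeasure (F.P (K₀ + K + 1)) (K₀ + K + 1) (SU N)))
    (hDom : ∀ s', kr K (keyB₁₃ θ K₀ g₀ K s') ∈ badClassK₁₃ θ K₀ g₀ kr bd K t → ∀ V,
      fibreIntegral (fib s') (fun V => chiSeqOfRecord F N θ.ν θ.τ9.M (histB₁₃ θ K₀ g₀ K) (K₀ + K + 1) (K₀ + K + 1) s' V *
          dressedSlotsOfDatum₉ F N θ.toStage9Params (datumOfRecord₁₃CoPH F N θ hP) g₀ os t (runB₁₃ F K₀ g₀ K) (histB₁₃ θ K₀ g₀ K) (K₀ + K + 1) s' V) V ≤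
        z s' * fibreIntegral (fib s') (fun V => chiSeqOfRecord F N θ.ν θ.τ9.M (histB₁₃ θ K₀ g₀ K) (K₀ + K + 1) (K₀ + K + 1) (rm s') V *
          dressedSlotsOfDatum₉ F N θ.toStage9Params (datumOfRecord₁₃CoPH F N θ hP) g₀ os t (runB₁₃ F K₀ g₀ K) (histB₁₃ θ K₀ g₀ K) (K₀ + K + 1) (rm s') V) V)
    (hW : ∀ σ, ∑ s' ∈ (Finset.univ.filter fun s' => kr K (keyB₁₃ θ K₀ g₀ K s') ∈ badClassK₁₃ θ K₀ g₀ kr bd K t).filter (fun s' => rm s' = σ), z s' ≤ W) :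
    ∑ u ∈ badClassK₁₃ θ K₀ g₀ kr bd K t, weightBK₁₃ θ hP K₀ g₀ os kr K t u ≤ W * ∑ u ∈ classSetK₁₃ θ K₀ g₀ kr K, weightBK₁₃ θ hP K₀ g₀ os kr K t u := by
  rw [sum_badK_weightBK₁₃_eq_sum_hist, sum_classSetK_weightBK₁₃_eq_sum_hist]
  have h0 : ∀ s' V, 0 ≤ chiSeqOfRecord F N θ.ν θ.τ9.M (histB₁₃ θ K₀ g₀ K) (K₀ + K + 1) (K₀ + K + 1) s' V *
      dressedSlotsOfDatum₉ F N θ.toStage9Params (datumOfRecord₁₃CoPH F N θ hP) g₀ os t (runB₁₃ F K₀ g₀ K) (histB₁₃ θ K₀ g₀ K) (K₀ + K + 1) s' V :=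
    fun s' V => mul_nonneg (chiSeqOfRecord_nonneg F N θ.ν θ.τ9.M _ _ _ s' V)
      (dressedSlotsOfDatum₉_nonneg F N θ.toStage9Params (datumOfRecord₁₃CoPH F N θ hP) g₀ os (runB₁₃ F K₀ g₀ K) (histB₁₃ θ K₀ g₀ K)
        (wOfRecord₉_nonneg_of_provisos₁₃CoPH F θ hP (runB₁₃ F K₀ g₀ K) (histB₁₃ θ K₀ g₀ K)) t (K₀ + K + 1) s' V)
  exact sum_classWeightOfDatum₉_le_mul_sum_of_fibreDom θ.toStage9Params (datumOfRecord₁₃CoPH F N θ hP) g₀ os (runB₁₃ F K₀ g₀ K) (histB₁₃ θ K₀ g₀ K)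
    (K₀ + K + 1) t _ rm fib z hW0 hm h0 hint (fun s hs => hDom s (Finset.mem_filter.1 hs).2) (fun σ _ => hW σ)

end Letters

/-! ## §3 The component-size face at the block-grain cardinality dial from per-history fibrewise letters -/

section Face

variable (θ : Stage13HParams F N) (hP : θ.Provisos₁₃CoPH F N) (K₀ : ℕ) (g₀ : ℕ → ℝ) (os : List (ULoop F))
  (kr : ℕ → (Σ K, SiteSeqKey F (K₀ + K)) → (Σ K, SiteSeqKey F (K₀ + K))) (jcut : ℕ → ℕ) (n lv : ℕ → ℕ → ℕ)

open scoped Classical in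
/-- ★★★ **THE N20 FACE AT THE BLOCK-GRAIN CARDINALITY DIAL FROM PER-HISTORY FIBREWISE LETTERS** (gen 33's `relWeightBound_card_of_blockEnergyLetters_geometric` with its block energy letters
hEA ∕ hEB DISCHARGED by §2): for every `(K, t)` with `|t| ≤ 1`, every level `j ∈ [1, jcut K]` and every member `p = (y₀, A)` of the block-grain cover family, EACH RUN supplies removal data —
a removal map on its final-level histories, fibre sets and factors — carrying the fibrewise letter on the histories whose coarse key has its level-`j` large-field region covering `A`
and the fibre count `≤ δ K j ^ n K j`; with the displayed measurability ∕ integrability of the dressed pieces and the face's schedule numerics (`0 ≤ δ ≤ δ₀`, `2·(3^4−1)²·δ₀ ≤ 1`,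
`n K j ≥ ⌈log₂|Site_{lv K j}|⌉ + K + j + 3`, `lv K j ≤ m + K₀ + K`, step-preserving dial): `RelWeightBound` at the coarse carriers with the component-size bad class and the geometric
weight `δ₀·2^{−(K+1)}`. [bookkeeping] -/
theorem relWeightBound_card_of_fibreDomLetters_geometric
    (hkr : ∀ (K : ℕ) (x : Σ K, SiteSeqKey F (K₀ + K)), x ∈ classSet₁₃ θ K₀ g₀ K → (kr K x).1 = K)
    {δ : ℕ → ℕ → ℝ} {δ₀ : ℝ} (hδ0 : ∀ K j, 0 ≤ δ K j) (hδ1 : ∀ K j, δ K j ≤ δ₀) (hD : 2 * ((3 : ℝ) ^ 4 - 1) ^ 2 * δ₀ ≤ 1)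
    (hn : ∀ K j, Nat.clog 2 (Fintype.card (Site (F.P (K₀ + K)) (lv K j))) + K + j + 3 ≤ n K j) (hlv : ∀ K j, lv K j ≤ F.m + (K₀ + K))
    (hmA : ∀ K t s, Measurable fun V => chiSeqOfRecord F N θ.ν θ.τ9.M (histA₁₃ θ K₀ g₀ K) (K₀ + K) (K₀ + K) s V *
      dressedSlotsOfDatum₉ F N θ.toStage9Params (datumOfRecord₁₃CoPH F N θ hP) g₀ os t (runA₁₃ F K₀ g₀ K) (histA₁₃ θ K₀ g₀ K) (K₀ + K) s V)
    (hintA : ∀ K t s, Integrable (fun V => chiSeqOfRecord F N θ.ν θ.τ9.M (histA₁₃ θ K₀ g₀ K) (K₀ + K) (K₀ + K) s V *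
      dressedSlotsOfDatum₉ F N θ.toStage9Params (datumOfRecord₁₃CoPH F N θ hP) g₀ os t (runA₁₃ F K₀ g₀ K) (histA₁₃ θ K₀ g₀ K) (K₀ + K) s V)
      (fieldMeasure (F.P (K₀ + K)) (K₀ + K) (SU N)))
    (hmB : ∀ K t s', Measurable fun V => chiSeqOfRecord F N θ.ν θ.τ9.M (histB₁₃ θ K₀ g₀ K) (K₀ + K + 1) (K₀ + K + 1) s' V *
      dressedSlotsOfDatum₉ F N θ.toStage9Params (datumOfRecord₁₃CoPH F N θ hP) g₀ os t (runB₁₃ F K₀ g₀ K) (histB₁₃ θ K₀ g₀ K) (K₀ + K + 1) s' V)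
    (hintB : ∀ K t s', Integrable (fun V => chiSeqOfRecord F N θ.ν θ.τ9.M (histB₁₃ θ K₀ g₀ K) (K₀ + K + 1) (K₀ + K + 1) s' V *
      dressedSlotsOfDatum₉ F N θ.toStage9Params (datumOfRecord₁₃CoPH F N θ hP) g₀ os t (runB₁₃ F K₀ g₀ K) (histB₁₃ θ K₀ g₀ K) (K₀ + K + 1) s' V)
      (fieldMeasure (F.P (K₀ + K + 1)) (K₀ + K + 1) (SU N)))
    (hLA : ∀ (K : ℕ) (t : ℝ), |t| ≤ 1 → ∀ j ∈ Finset.Icc 1 (jcut K), ∀ p ∈ animalCoverFamily (SiteTouch (P := F.P (K₀ + K)) (j := lv K j)) (n K j),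
      ∃ (rm : SeqOfRecord F θ.ν θ.τ9.M (histA₁₃ θ K₀ g₀ K) (K₀ + K) (K₀ + K) → SeqOfRecord F θ.ν θ.τ9.M (histA₁₃ θ K₀ g₀ K) (K₀ + K) (K₀ + K))
        (fib : SeqOfRecord F θ.ν θ.τ9.M (histA₁₃ θ K₀ g₀ K) (K₀ + K) (K₀ + K) → Finset (PBond (F.P (K₀ + K)) (K₀ + K)))
        (z : SeqOfRecord F θ.ν θ.τ9.M (histA₁₃ θ K₀ g₀ K) (K₀ + K) (K₀ + K) → ℝ),
        (∀ s, kr K (keyA₁₃ θ K₀ g₀ K s) ∈ badClassK₁₃ θ K₀ g₀ kr (fun _ u => ∀ y : SiteSeqKey F (K₀ + K), u = ⟨K, y⟩ →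
            (↑p.2 : Set (Site (F.P (K₀ + K)) (lv K j))) ⊆ iterBlockOf (lv K j) '' (y.2 j)ᶜ) K t → ∀ V,
          fibreIntegral (fib s) (fun V => chiSeqOfRecord F N θ.ν θ.τ9.M (histA₁₃ θ K₀ g₀ K) (K₀ + K) (K₀ + K) s V *
              dressedSlotsOfDatum₉ F N θ.toStage9Params (datumOfRecord₁₃CoPH F N θ hP) g₀ os t (runA₁₃ F K₀ g₀ K) (histA₁₃ θ K₀ g₀ K) (K₀ + K) s V) V ≤
            z s * fibreIntegral (fib s) (fun V => chiSeqOfRecord F N θ.ν θ.τ9.M (histA₁₃ θ K₀ g₀ K) (K₀ + K) (K₀ + K) (rm s) V *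
              dressedSlotsOfDatum₉ F N θ.toStage9Params (datumOfRecord₁₃CoPH F N θ hP) g₀ os t (runA₁₃ F K₀ g₀ K) (histA₁₃ θ K₀ g₀ K) (K₀ + K) (rm s) V) V) ∧
        (∀ σ, ∑ s ∈ (Finset.univ.filter fun s => kr K (keyA₁₃ θ K₀ g₀ K s) ∈ badClassK₁₃ θ K₀ g₀ kr (fun _ u => ∀ y : SiteSeqKey F (K₀ + K), u = ⟨K, y⟩ →
            (↑p.2 : Set (Site (F.P (K₀ + K)) (lv K j))) ⊆ iterBlockOf (lv K j) '' (y.2 j)ᶜ) K t).filter (fun s => rm s = σ), z s ≤ δ K j ^ n K j))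
    (hLB : ∀ (K : ℕ) (t : ℝ), |t| ≤ 1 → ∀ j ∈ Finset.Icc 1 (jcut K), ∀ p ∈ animalCoverFamily (SiteTouch (P := F.P (K₀ + K)) (j := lv K j)) (n K j),
      ∃ (rm : SeqOfRecord F θ.ν θ.τ9.M (histB₁₃ θ K₀ g₀ K) (K₀ + K + 1) (K₀ + K + 1) → SeqOfRecord F θ.ν θ.τ9.M (histB₁₃ θ K₀ g₀ K) (K₀ + K + 1) (K₀ + K + 1))
        (fib : SeqOfRecord F θ.ν θ.τ9.M (histB₁₃ θ K₀ g₀ K) (K₀ + K + 1) (K₀ + K + 1) → Finset (PBond (F.P (K₀ + K + 1)) (K₀ + K + 1)))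
        (z : SeqOfRecord F θ.ν θ.τ9.M (histB₁₃ θ K₀ g₀ K) (K₀ + K + 1) (K₀ + K + 1) → ℝ),
        (∀ s', kr K (keyB₁₃ θ K₀ g₀ K s') ∈ badClassK₁₃ θ K₀ g₀ kr (fun _ u => ∀ y : SiteSeqKey F (K₀ + K), u = ⟨K, y⟩ →
            (↑p.2 : Set (Site (F.P (K₀ + K)) (lv K j))) ⊆ iterBlockOf (lv K j) '' (y.2 j)ᶜ) K t → ∀ V,
          fibreIntegral (fib s') (fun V => chiSeqOfRecord F N θ.ν θ.τ9.M (histB₁₃ θ K₀ g₀ K) (K₀ + K + 1) (K₀ + K + 1) s' V *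
              dressedSlotsOfDatum₉ F N θ.toStage9Params (datumOfRecord₁₃CoPH F N θ hP) g₀ os t (runB₁₃ F K₀ g₀ K) (histB₁₃ θ K₀ g₀ K) (K₀ + K + 1) s' V) V ≤
            z s' * fibreIntegral (fib s') (fun V => chiSeqOfRecord F N θ.ν θ.τ9.M (histB₁₃ θ K₀ g₀ K) (K₀ + K + 1) (K₀ + K + 1) (rm s') V *
              dressedSlotsOfDatum₉ F N θ.toStage9Params (datumOfRecord₁₃CoPH F N θ hP) g₀ os t (runB₁₃ F K₀ g₀ K) (histB₁₃ θ K₀ g₀ K) (K₀ + K + 1) (rm s') V) V) ∧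
        (∀ σ, ∑ s' ∈ (Finset.univ.filter fun s' => kr K (keyB₁₃ θ K₀ g₀ K s') ∈ badClassK₁₃ θ K₀ g₀ kr (fun _ u => ∀ y : SiteSeqKey F (K₀ + K), u = ⟨K, y⟩ →
            (↑p.2 : Set (Site (F.P (K₀ + K)) (lv K j))) ⊆ iterBlockOf (lv K j) '' (y.2 j)ᶜ) K t).filter (fun s' => rm s' = σ), z s' ≤ δ K j ^ n K j)) :
    RelWeightBound 1 (classSetK₁₃ θ K₀ g₀ kr) (weightAK₁₃ θ hP K₀ g₀ os kr) (weightBK₁₃ θ hP K₀ g₀ os kr)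
      (badClassK₁₃ θ K₀ g₀ kr (badKeyReadingOfBigComponent₁₃ N K₀ jcut (bigDialOfCard₁₃ K₀ (fun K j => n K j * (F.L ^ 4) ^ lv K j)) F θ hP g₀ os))
      (fun K => δ₀ * (1 / 2) ^ (K + 1)) := by
  refine relWeightBound_card_of_blockEnergyLetters_geometric θ hP K₀ g₀ os kr jcut n lv hkr hδ0 hδ1 hD hn hlv ?_ ?_
  · intro K t ht j hj p hp
    obtain ⟨rm, fib, z, hDom, hW⟩ := hLA K t ht j hj p hp
    exact badMassA_le_of_fibreDom θ hP K₀ g₀ os kr _ K t rm fib z (pow_nonneg (hδ0 K j) _) (hmA K t) (hintA K t) hDom hW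
  · intro K t ht j hj p hp
    obtain ⟨rm, fib, z, hDom, hW⟩ := hLB K t ht j hj p hp
    exact badMassB_le_of_fibreDom θ hP K₀ g₀ os kr _ K t rm fib z (pow_nonneg (hδ0 K j) _) (hmB K t) (hintB K t) hDom hW

end Face

end YMDAG.UVSplit
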